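import Summits.SmoothPoincare4.SmoothPoincare4.Theorems.CongruenceShadowsHeegaardHandlebodyCongruenceClosedReduction
import Summits.SmoothPoincare4.SmoothPoincare4.Theorems.CongruenceShadowsHeegaardHandlebodyCongruenceClosedStubPairShadowFiniteQuotients
import Summits.SmoothPoincare4.SmoothPoincare4.Theorems.CongruenceShadowsHeegaardHandlebodyCongruenceClosedStubProfiniteFreenessDetection
import Summits.SmoothPoincare4.SmoothPoincare4.Theorems.CongruenceShadowsHeegaardHandlebodyCongruenceClosedStubIsProductOfPrincipalLeftFamily

/-!
# Two equivalence certificates for crux `CongruenceShadows.HeegaardHandlebodyCongruenceClosed`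
(item stmt-SmoothPoincare4-14596, route route-SmoothPoincare4-CongruenceShadows; line `pair-rigidity-retraction`, lead c1)

Notation: `S = S_{3+3m} = SurfaceGroup (3+3m)`, `N = (N₀,N₁,N₂) = s4Kernels.stabilizeIter m` (standard genus-`(3+3m)`
trisection kernels of `S⁴`), `H = Stab N₀ ∩ Stab N₁`, `C = Stab N₂` (subsets of `Aut S`), `K_M = ker (Aut S → Aut (S ⧸ M))`.
The crux says that the product set `H·C` is closed in the congruence topology: a `ρ` congruent to some `x_M ∘ c_M`
modulo every characteristic finite-index `M` ("product-congruent") is a product `x ∘ c`.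

* `crux_iff_limitsSimplyConnectedPos_of_items` (registered stub `stub_cruxIffLimitsSimplyConnectedPosOfItems`) — **modulo
  the three sibling route items** stmt-SmoothPoincare4-15157 `HeegaardPairFreenessDetection` (Wilton–Zalesskii profinite
  detection of `#ᵏ(S¹×S²)` for Heegaard-pair quotients), stmt-SmoothPoincare4-14595 `ShadowApproximation` and
  stmt-SmoothPoincare4-14592 `WaldhausenPairs`, **the crux is EQUIVALENT to the line's single private stub P3**
  `stub_limitsSimplyConnected` (limits are simply connected, genera `≥ 6`: `N₀ ⊔ N₁ ⊔ ρN₂ = ⊤` for every product-congruent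
  `ρ`).  `⇐` is the landed composition `hhcc_of_parts` with P1 (`stub_pairShadowFiniteQuotients`) proved and P2 derived from
  item 15157 (`stub_profiniteFreenessDetection_of_fact`); `⇒` is the landed necessity `limitsSimplyConnected_of_hhcc`
  (unconditional).  This is the exact statement a planner needs to promote P3 to a route item.
* `crux_iff_principalLeftFamilies` (registered stub `stub_cruxIffPrincipalLeftFamilies`) — an **unconditional reformulation
  of the crux inside the Goeritz group `H`**: the crux holds iff every product-congruent `ρ` admits a PRINCIPAL family of
  left factors, i.e. one `x ∈ H` such that at every level `M` some admissible left factor `y = x_M` (with `ρ ≡ y ∘ c_M`)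
  satisfies `y ≡ x ∘ c'_M (mod M)` for some `c'_M ∈ C` — in words, the classes of the `x_M` in the finite sets
  `H ⧸ (H ∩ C·K_M)` come from a single element of `H`.  `⇐` is the landed left criterion
  `isProduct_of_principalLeftFamily`; `⇒` takes `y := x`, `c := c`, `c' := 1` from the product decomposition.
-/

noncomputable section

-- the prescribed namespace `Summit.<P>.<Sub>.…` duplicates `SmoothPoincare4` (P = Sub)
set_option linter.dupNamespace false

namespace Summit.SmoothPoincare4.SmoothPoincare4.Theorems.HeegaardHandlebodyCongruenceClosed.PairRigidityRetraction

open Literature.Topology.FourManifolds Subgroup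
open Summit.SmoothPoincare4.SmoothPoincare4.Theses.CongruenceShadows
  (HeegaardHandlebodyCongruenceClosed ShadowApproximation WaldhausenPairs HeegaardPairFreenessDetection)

/-! ## Modulo the sibling items the crux is P3 -/

/-- **Crux ⟺ P3, given items 15157, 14595, 14592.**  Under `HeegaardPairFreenessDetection` (stmt-15157),
`ShadowApproximation` (stmt-14595) and `WaldhausenPairs` (stmt-14592), the crux `HeegaardHandlebodyCongruenceClosed` holds
if and only if limits are simply connected at genera `≥ 6`: for every `m` and every product-congruent
`ρ ∈ Aut S_{3+3(m+1)}`, `N₀ ⊔ N₁ ⊔ ρN₂ = ⊤`.  (`⇒` does not use the items.) [folklore] -/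
theorem crux_iff_limitsSimplyConnectedPos_of_items (h57 : HeegaardPairFreenessDetection)
    (hSA : ShadowApproximation) (hW : WaldhausenPairs) :
    HeegaardHandlebodyCongruenceClosed ↔
      ∀ (m : ℕ) (ρ : SurfaceGroup (3 + 3 * (m + 1)) ≃* SurfaceGroup (3 + 3 * (m + 1))),
        (∀ M : Subgroup (SurfaceGroup (3 + 3 * (m + 1))), M.Characteristic → M.FiniteIndex →
          ∃ x c : SurfaceGroup (3 + 3 * (m + 1)) ≃* SurfaceGroup (3 + 3 * (m + 1)),
            (s4Kernels.stabilizeIter (m + 1) 0).map x.toMonoidHom = s4Kernels.stabilizeIter (m + 1) 0 ∧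
            (s4Kernels.stabilizeIter (m + 1) 1).map x.toMonoidHom = s4Kernels.stabilizeIter (m + 1) 1 ∧
            (s4Kernels.stabilizeIter (m + 1) 2).map c.toMonoidHom = s4Kernels.stabilizeIter (m + 1) 2 ∧
            ∀ s, ρ s * (x (c s))⁻¹ ∈ M) →
        s4Kernels.stabilizeIter (m + 1) 0 ⊔ s4Kernels.stabilizeIter (m + 1) 1 ⊔
          (s4Kernels.stabilizeIter (m + 1) 2).map ρ.toMonoidHom = ⊤ :=
  ⟨fun hC m ρ hρ => limitsSimplyConnected_of_hhcc hC (m + 1) ρ hρ,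
   fun hP3 => hhcc_of_parts stub_pairShadowFiniteQuotients (stub_profiniteFreenessDetection_of_fact h57) hP3 hSA hW⟩

/-- **Registered stub `stub_cruxIffLimitsSimplyConnectedPosOfItems` of line `pair-rigidity-retraction`** (signature
verbatim as registered on stmt-SmoothPoincare4-14596): `= crux_iff_limitsSimplyConnectedPos_of_items`. [folklore] -/
theorem stub_cruxIffLimitsSimplyConnectedPosOfItems : Summit.SmoothPoincare4.SmoothPoincare4.Theses.CongruenceShadows.HeegaardPairFreenessDetection → Summit.SmoothPoincare4.SmoothPoincare4.Theses.CongruenceShadows.ShadowApproximation → Summit.SmoothPoincare4.SmoothPoincare4.Theses.CongruenceShadows.WaldhausenPairs → (Summit.SmoothPoincare4.SmoothPoincare4.Theses.CongruenceShadows.HeegaardHandlebodyCongruenceClosed ↔ ∀ (m : ℕ) (ρ : Literature.Topology.FourManifolds.SurfaceGroup (3 + 3 * (m + 1)) ≃* Literature.Topology.FourManifolds.SurfaceGroup (3 + 3 * (m + 1))), (∀ M : Subgroup (Literature.Topology.FourManifolds.SurfaceGroup (3 + 3 * (m + 1))), M.Characteristic → M.FiniteIndex → ∃ x c : Literature.Topology.FourManifolds.SurfaceGroup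 (3 + 3 * (m + 1)) ≃* Literature.Topology.FourManifolds.SurfaceGroup (3 + 3 * (m + 1)), (Literature.Topology.FourManifolds.s4Kernels.stabilizeIter (m + 1) 0).map x.toMonoidHom = Literature.Topology.FourManifolds.s4Kernels.stabilizeIter (m + 1) 0 ∧ (Literature.Topology.FourManifolds.s4Kernels.stabilizeIter (m + 1) 1).map x.toMonoidHom = Literature.Topology.FourManifolds.s4Kernels.stabilizeIter (m + 1) 1 ∧ (Literature.Topology.FourManifolds.s4Kernels.stabilizeIter (m + 1) 2).map c.toMonoidHom = Literature.Topology.FourManifolds.s4Kernels.stabilizeIter (m + 1) 2 ∧ ∀ s, ρ s * (x (c s))⁻¹ ∈ M) → Literature.Topology.FourManifolds.s4Kernels.stabilizeIter (m + 1) 0 ⊔ Literature.Topology.FourManifolds.s4Kernels.stabilizeIter (m + 1) 1 ⊔ (Literature.Topology.FourManifolds.s4Kernels.stabilizeIter (m + 1) 2).map ρ.toMonoidHom = ⊤) :=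
  fun h57 hSA hW => crux_iff_limitsSimplyConnectedPos_of_items h57 hSA hW

/-! ## The crux inside the Goeritz group: principal left-factor families -/

/-- **Crux ⟺ every product-congruent `ρ` has a principal family of left factors** (unconditional).  `⇒`: if
`ρ = x ∘ c` then `y := x`, `c_M := c`, `c'_M := 1` serve at every level.  `⇐`: the landed left criterion
`isProduct_of_principalLeftFamily` (closedness of `N₂` in the characteristic profinite topology of `S`). [folklore] -/
theorem crux_iff_principalLeftFamilies :
    HeegaardHandlebodyCongruenceClosed ↔
      ∀ (m : ℕ) (ρ : SurfaceGroup (3 + 3 * m) ≃* SurfaceGroup (3 + 3 * m)),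
        (∀ M : Subgroup (SurfaceGroup (3 + 3 * m)), M.Characteristic → M.FiniteIndex →
          ∃ x c : SurfaceGroup (3 + 3 * m) ≃* SurfaceGroup (3 + 3 * m),
            (s4Kernels.stabilizeIter m 0).map x.toMonoidHom = s4Kernels.stabilizeIter m 0 ∧
            (s4Kernels.stabilizeIter m 1).map x.toMonoidHom = s4Kernels.stabilizeIter m 1 ∧
            (s4Kernels.stabilizeIter m 2).map c.toMonoidHom = s4Kernels.stabilizeIter m 2 ∧
            ∀ s, ρ s * (x (c s))⁻¹ ∈ M) →
        ∃ x : SurfaceGroup (3 + 3 * m) ≃* SurfaceGroup (3 + 3 * m),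
          (s4Kernels.stabilizeIter m 0).map x.toMonoidHom = s4Kernels.stabilizeIter m 0 ∧
          (s4Kernels.stabilizeIter m 1).map x.toMonoidHom = s4Kernels.stabilizeIter m 1 ∧
          ∀ M : Subgroup (SurfaceGroup (3 + 3 * m)), M.Characteristic → M.FiniteIndex →
            ∃ y c c' : SurfaceGroup (3 + 3 * m) ≃* SurfaceGroup (3 + 3 * m),
              (s4Kernels.stabilizeIter m 0).map y.toMonoidHom = s4Kernels.stabilizeIter m 0 ∧
              (s4Kernels.stabilizeIter m 1).map y.toMonoidHom = s4Kernels.stabilizeIter m 1 ∧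
              (s4Kernels.stabilizeIter m 2).map c.toMonoidHom = s4Kernels.stabilizeIter m 2 ∧
              (s4Kernels.stabilizeIter m 2).map c'.toMonoidHom = s4Kernels.stabilizeIter m 2 ∧
              (∀ s, ρ s * (y (c s))⁻¹ ∈ M) ∧ ∀ s, y s * (x (c' s))⁻¹ ∈ M := by
  constructor
  · intro hC m ρ hρ
    obtain ⟨x, c, hx0, hx1, hc, hs⟩ := hC m ρ hρ
    refine ⟨x, hx0, hx1, fun M _ _ => ⟨x, c, MulEquiv.refl _, hx0, hx1, hc, ?_, fun s => ?_, fun s => ?_⟩⟩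
    · simp
    · rw [hs s, mul_inv_cancel]
      exact one_mem M
    · rw [MulEquiv.refl_apply, mul_inv_cancel]
      exact one_mem M
  · intro h m ρ hρ
    obtain ⟨x, hx0, hx1, hfam⟩ := h m ρ hρ
    exact isProduct_of_principalLeftFamily x hx0 hx1 hfam

/-- **Registered stub `stub_cruxIffPrincipalLeftFamilies` of line `pair-rigidity-retraction`** (signature verbatim as
registered on stmt-SmoothPoincare4-14596): `= crux_iff_principalLeftFamilies`. [folklore] -/
theorem stub_cruxIffPrincipalLeftFamilies : Summit.SmoothPoincare4.SmoothPoincare4.Theses.CongruenceShadows.HeegaardHandlebodyCongruenceClosed ↔ ∀ (m : ℕ) (ρ : Literature.Topology.FourManifolds.SurfaceGroup (3 + 3 * m) ≃* Literature.Topology.FourManifolds.SurfaceGroup (3 + 3 * m)), (∀ M : Subgroup (Literature.Topology.FourManifolds.SurfaceGroup (3 + 3 * m)), M.Characteristic → M.FiniteIndex → ∃ x c : Literature.Topology.FourManifolds.SurfaceGroup (3 + 3 * m) ≃* Literature.Topology.FourManifolds.SurfaceGroup (3 + 3 * m), (Literature.Topology.FourManifolds.s4Kernels.stabilizeIter m 0).map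 x.toMonoidHom = Literature.Topology.FourManifolds.s4Kernels.stabilizeIter m 0 ∧ (Literature.Topology.FourManifolds.s4Kernels.stabilizeIter m 1).map x.toMonoidHom = Literature.Topology.FourManifolds.s4Kernels.stabilizeIter m 1 ∧ (Literature.Topology.FourManifolds.s4Kernels.stabilizeIter m 2).map c.toMonoidHom = Literature.Topology.FourManifolds.s4Kernels.stabilizeIter m 2 ∧ ∀ s, ρ s * (x (c s))⁻¹ ∈ M) → ∃ x : Literature.Topology.FourManifolds.SurfaceGroup (3 + 3 * m) ≃* Literature.Topology.FourManifolds.SurfaceGroup (3 + 3 * m), (Literature.Topology.FourManifolds.s4Kernels.stabilizeIter m 0).map x.toMonoidHom = Literature.Topology.FourManifolds.s4Kernels.stabilizeIter m 0 ∧ (Literature.Topology.FourManifolds.s4Kernels.stabilizeIter m 1).map x.toMonoidHom = Literature.Topology.FourManifolds.s4Kernels.stabilizeIter m 1 ∧ ∀ M : Subgroup (Literature.Topology.FourManifolds.SurfaceGroup (3 + 3 * m)), M.Characteristic → M.FiniteIndex → ∃ y c c' : Literature.Topology.FourManifolds.SurfaceGroup (3 + 3 * m) ≃* Literature.Topology.FourManifolds.SurfaceGroup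 (3 + 3 * m), (Literature.Topology.FourManifolds.s4Kernels.stabilizeIter m 0).map y.toMonoidHom = Literature.Topology.FourManifolds.s4Kernels.stabilizeIter m 0 ∧ (Literature.Topology.FourManifolds.s4Kernels.stabilizeIter m 1).map y.toMonoidHom = Literature.Topology.FourManifolds.s4Kernels.stabilizeIter m 1 ∧ (Literature.Topology.FourManifolds.s4Kernels.stabilizeIter m 2).map c.toMonoidHom = Literature.Topology.FourManifolds.s4Kernels.stabilizeIter m 2 ∧ (Literature.Topology.FourManifolds.s4Kernels.stabilizeIter m 2).map c'.toMonoidHom = Literature.Topology.FourManifolds.s4Kernels.stabilizeIter m 2 ∧ (∀ s, ρ s * (y (c s))⁻¹ ∈ M) ∧ ∀ s, y s * (x (c' s))⁻¹ ∈ M :=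
  crux_iff_principalLeftFamilies

end Summit.SmoothPoincare4.SmoothPoincare4.Theorems.HeegaardHandlebodyCongruenceClosed.PairRigidityRetraction

end
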